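import Literature.NumberTheory.DiophantineGeometry.SUnitMordellHeightBoundsModularity
import HarnessLib

/-!
# Effective `S`-unit and `abc` bounds from the congruence number of modular forms
# (Murty–Pasten 2013, Theorems 1.1 and 1.2)

Topic `Literature/NumberTheory/DiophantineGeometry` (family `abc`; LADDER-ABC A1, the *modular method*:
modularity of elliptic curves over `ℚ` + Ribet's congruence number + Frey curves, no linear forms in
logarithms). This file TYPES, as cite-tagged statements in the currency of
`SUnitMordellHeightBoundsModularity.lean` (von Känel–Matschke: `VonKanelMatschke.IsSUnit`,
`VonKanelMatschke.primesProd`, Mathlib's `Height.logHeight₁` on `ℚ`, signed integer `abc` triples with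
`UniqueFactorizationMonoid.radical (a * b * c).natAbs`), the two theorems of the introduction of

* M. R. Murty, H. Pasten, *Modular forms and effective Diophantine approximation*, J. Number Theory
  **133** (2013) 3739–3754 [`MurtyPasten2013`] — version of record HELD (`paper:url-b819d9c52ca6`) and
  read in full; locators are its theorem numbers and journal pages.

> **Theorem 1.1** (p. 3740). *Let `S` be a finite set of primes in `ℤ` and let `P` be the product of the
> elements of `S`. If `U, V ∈ ℤ_S^×` satisfy `U + V = 1` then `max{h(U), h(V)} < 4.8 P log P + 13 P + 25`.
> […] Moreover, as we vary the set `S` we get `max{h(U), h(V)} < 4 P log P + O(P log log P)`.*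
>
> **Theorem 1.2** (p. 3741). *Let `A, B, C` be coprime non-zero integers with `A + B = C`. Let
> `R = rad(ABC)` […]. Then `log max{|A|, |B|, |C|} < 4.8 R log R + 13 R + 25`. Moreover, as we vary the
> triple `A, B, C` we have `log max{|A|, |B|, |C|} ≤ 4 R log R + O(R log log R)`.*

"An equivalent way to state the previous theorem is the following" (p. 3741, before Thm 1.2); §8
(p. 3752–3753) proves Thm 1.2 from the height bound Thm 7.1 (`log|Δ_E| < 1.2 N log N + 93`, typed in
`Literature/NumberTheory/EllipticCurves/CongruenceNumberLevelBound.lean`) on the Frey–Hellegouarch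
curve (`2⁸|Δ_E| ≥ (ABC)²`, `N_E ∣ 2⁴ rad(ABC)` [Diamond–Kramer]) and Thm 1.1 from Thm 1.2 by
`U = −A/C`, `V = −B/C`.

## Contents

* `MurtyPasten.sUnit_height_lt` (Thm 1.1, explicit), `MurtyPasten.abc_log_max_lt` (Thm 1.2, explicit),
  `MurtyPasten.sUnit_height_asymptotic`, `MurtyPasten.abc_log_max_asymptotic` (the "moreover" clauses)
  — statements in print, `def … : Prop` (D-0014).
* PROVED: `sUnit_height_lt_of_abc_log_max_lt` (the printed proof of Thm 1.1 from Thm 1.2, §8) and its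
  converse `abc_log_max_lt_of_sUnit_height_lt` ("an equivalent way to state"), so
  `sUnit_height_lt_iff_abc_log_max_lt`; `sUnit_height_lt_of_vonKanelMatschke`: the explicit Thm 1.1
  FOLLOWS from von Känel–Matschke's later Prop. 10.2 (`VonKanelMatschke.sUnitEquation_height_le`,
  `max(h(x),h(y)) ≤ (5/2) N_S log N_S + 9 N_S`, which "updates `h ≤ 4.8 N_S log N_S + 13 N_S + 25` in
  Murty–Pasten"), hence so does Thm 1.2 (`abc_log_max_lt_of_vonKanelMatschke`).
* In the companion `SUnitAbcBoundsCongruenceNumberProofs.lean` (PROVED): the `IsABCTriple` forms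
  `abcTriple_log_lt`, `bakerShapeBound_one_one` (`κ = 56`), `epsShapeBound_one` (the modular method
  reaches the tree's rung `Literature.Barriers.ABC.EpsShapeBound 1`, there PROVED via `p`-adic linear
  forms), and `sUnit_height_asymptotic_of_abc` (the asymptotic clause of Thm 1.1 from Thm 1.2).

## Faithfulness notes (read before discharging)

* ERRATUM (printed proof vs printed constants). §8 (p. 3752) displays
  `4 log max{|A|,|B|,|C|} − 2 log 2 < 19.2 R log R + 53.234 R + 98.546` and concludes Thm 1.2; division
  by `4` gives `13.31 R` (`= 1.2 · 2⁴ · log 2⁴ / 4 · R`), not the printed `13 R`. Moreover the input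
  `log|Δ_E| < 1.2 N log N + 93` (Thm 7.1) inherits the `12 log(2π)` normalisation slip of MP's Thm 5.1
  (see the module docstring of `CongruenceNumberLevelBound.lean`): along the printed argument with
  Silverman's formula as corrected in Pasten 2024 (§3, Lemma 18.1) one obtains
  `log max < 4.8 R log R + 13.31 R + 30.5`. The statements below are nevertheless recorded VERBATIM
  (they are what is in print, and what von Känel–Matschke and Pasten 2024 quote), and they are TRUE as
  printed: both follow from von Känel–Matschke's Prop. 10.2 (proved in print by the same modular
  method with Faltings heights handled directly), as certified here by
  `sUnit_height_lt_of_vonKanelMatschke` / `abc_log_max_lt_of_vonKanelMatschke`. A discharge should go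
  through that route, not through MP §8.
* "coprime non-zero integers `A, B, C` with `A + B = C`" is rendered, as in the sibling file, by
  `a ≠ 0, b ≠ 0, c ≠ 0, a + b = c, gcd(gcd(a,b),c) = 1` (for `a + b = c` this is pairwise coprimality);
  `h` is Mathlib's `Height.logHeight₁` (`h(m/n) = log max(|m|,|n|)`, `Rat.logHeight₁_eq_log_max`), which
  is MP's `h(q) = log max{|a|,|b|}` (p. 3740); `ℤ_S^×` is `VonKanelMatschke.IsSUnit S`,
  `P = VonKanelMatschke.primesProd S`.
* The `O(·)` clauses ("as we vary the set `S`" / "the triple") are rendered with an absolute constant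
  and a threshold (`∃ C P₀, ∀ …, P₀ ≤ P → … ≤ 4 P log P + C · P log log P`), with `≤` (weaker than the
  printed `<` of Thm 1.1; immaterial inside `O`).

## References

* [MurtyPasten2013] M. R. Murty, H. Pasten, J. Number Theory 133 (2013) 3739–3754: Thm 1.1 (p. 3740),
  Thm 1.2 (p. 3741), §8 (pp. 3752–3753). doi:10.1016/j.jnt.2013.05.006.
* [VonkanelMatschke2023] R. von Känel, B. Matschke, Mem. AMS 286 (2023) = arXiv:1605.06079, Prop. 10.2
  (the sentence "updates … Murty–Pasten").
* [PastenShimura2024] H. Pasten, J. Number Theory 254 (2024) = arXiv:1705.09251, §1.3 p. 6 (the estimate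
  (1.2) `h(E) ≪ N log N` "used by Murty and Pasten to give explicit and effective bounds … for the
  `S`-unit equation").
-/

noncomputable section

open Height UniqueFactorizationMonoid

namespace Literature.NumberTheory.DiophantineGeometry

namespace MurtyPasten

open VonKanelMatschke

/-! ### The statements in print -/

/-- **Murty–Pasten 2013, Theorem 1.1 (explicit `S`-unit bound).** "Let `S` be a finite set of primes in
`ℤ` and let `P` be the product of the elements of `S`. If `U, V ∈ ℤ_S^×` satisfy `U + V = 1` then
`max{h(U), h(V)} < 4.8 P log P + 13 P + 25`." (`h` the logarithmic height on `ℚ`, `ℤ_S^×` the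
`S`-units.) Proved in print from Thm 1.2 (`sUnit_height_lt_of_abc_log_max_lt`); implied by
von Känel–Matschke's Prop. 10.2 (`sUnit_height_lt_of_vonKanelMatschke`). See the module docstring
(ERRATUM) for the constants the printed argument actually yields.
[cite: MurtyPasten2013, Thm 1.1 (p. 3740)] -/
def sUnit_height_lt : Prop :=
  ∀ (S : Finset ℕ), (∀ p ∈ S, p.Prime) → ∀ U V : ℚ, IsSUnit S U → IsSUnit S V → U + V = 1 →
    max (logHeight₁ U) (logHeight₁ V) <
      4.8 * (primesProd S : ℝ) * Real.log (primesProd S) + 13 * (primesProd S : ℝ) + 25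

/-- **Murty–Pasten 2013, Theorem 1.1, second part** ("as we vary the set `S` we get
`max{h(U), h(V)} < 4 P log P + O(P log log P)`"), rendered with an absolute `O`-constant `C` and a
threshold `P₀`. [cite: MurtyPasten2013, Thm 1.1 (p. 3740, second display)] -/
def sUnit_height_asymptotic : Prop :=
  ∃ C P₀ : ℝ, ∀ (S : Finset ℕ), (∀ p ∈ S, p.Prime) → P₀ ≤ (primesProd S : ℝ) →
    ∀ U V : ℚ, IsSUnit S U → IsSUnit S V → U + V = 1 →
      max (logHeight₁ U) (logHeight₁ V) ≤
        4 * (primesProd S : ℝ) * Real.log (primesProd S) +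
          C * (primesProd S : ℝ) * Real.log (Real.log (primesProd S))

/-- **Murty–Pasten 2013, Theorem 1.2 (explicit `abc` bound).** "Let `A, B, C` be coprime non-zero
integers with `A + B = C`. Let `R = rad(ABC)` be the radical of `ABC` […]. Then
`log max{|A|, |B|, |C|} < 4.8 R log R + 13 R + 25`." ("An equivalent way to state" Thm 1.1:
`sUnit_height_lt_iff_abc_log_max_lt`.) The printed proof (§8: Frey–Hellegouarch curve with
`2⁸|Δ_E| ≥ (ABC)²`, `N_E ∣ 2⁴ rad(ABC)`, and Thm 7.1) yields `13.31 R` rather than `13 R` (module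
docstring, ERRATUM); the statement as printed follows from von Känel–Matschke's Prop. 10.2
(`abc_log_max_lt_of_vonKanelMatschke`). [cite: MurtyPasten2013, Thm 1.2 (p. 3741)] -/
def abc_log_max_lt : Prop :=
  ∀ a b c : ℤ, a ≠ 0 → b ≠ 0 → c ≠ 0 → a + b = c → Int.gcd (Int.gcd a b : ℤ) c = 1 →
    Real.log ((max |a| (max |b| |c|) : ℤ) : ℝ) <
      4.8 * ((radical (a * b * c).natAbs : ℕ) : ℝ) * Real.log ((radical (a * b * c).natAbs : ℕ) : ℝ) +
        13 * ((radical (a * b * c).natAbs : ℕ) : ℝ) + 25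

/-- **Murty–Pasten 2013, Theorem 1.2, second part** ("as we vary the triple `A, B, C` we have
`log max{|A|, |B|, |C|} ≤ 4 R log R + O(R log log R)`"), rendered with an absolute `O`-constant `C` and
a threshold `r₀` on `R = rad(ABC)`. (Superseded in print by von Känel–Matschke's
`(9/5) r log r + O(r log r / log log r)`, `VonKanelMatschke.abc_log_max_asymptotic`.)
[cite: MurtyPasten2013, Thm 1.2 (p. 3741, second display)] -/
def abc_log_max_asymptotic : Prop :=
  ∃ C r₀ : ℝ, ∀ a b c : ℤ, a ≠ 0 → b ≠ 0 → c ≠ 0 → a + b = c → Int.gcd (Int.gcd a b : ℤ) c = 1 →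
    r₀ ≤ ((radical (a * b * c).natAbs : ℕ) : ℝ) →
      Real.log ((max |a| (max |b| |c|) : ℤ) : ℝ) ≤
        4 * ((radical (a * b * c).natAbs : ℕ) : ℝ) * Real.log ((radical (a * b * c).natAbs : ℕ) : ℝ) +
          C * ((radical (a * b * c).natAbs : ℕ) : ℝ) * Real.log (Real.log ((radical (a * b * c).natAbs : ℕ) : ℝ))

/-! ### Thm 1.1 from von Känel–Matschke's Prop. 10.2 -/

/-- The explicit Thm 1.1 of Murty–Pasten follows from von Känel–Matschke's Prop. 10.2
(`max(h(x),h(y)) ≤ (5/2) N_S log N_S + 9 N_S`, which "updates `h ≤ 4.8 N_S log N_S + 13 N_S + 25` in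
Murty–Pasten"): `(5/2) P log P + 9 P < 4.8 P log P + 13 P + 25` as `P ≥ 1`.
[cite: VonkanelMatschke2023, Prop. 10.2 (sentence on Murty–Pasten)] -/
theorem sUnit_height_lt_of_vonKanelMatschke (h : sUnitEquation_height_le) : sUnit_height_lt := by
  intro S hS U V hU hV hUV
  have h1 := (h S hS U V hU hV hUV).1
  have hP1 : (1 : ℝ) ≤ (primesProd S : ℝ) := by exact_mod_cast one_le_primesProd hS
  have hlog : 0 ≤ Real.log (primesProd S) := Real.log_nonneg hP1
  have hPl : 0 ≤ (primesProd S : ℝ) * Real.log (primesProd S) := mul_nonneg (by linarith) hlog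
  calc max (logHeight₁ U) (logHeight₁ V)
      ≤ 5 / 2 * (primesProd S : ℝ) * Real.log (primesProd S) + 9 * (primesProd S : ℝ) := h1
    _ < 4.8 * (primesProd S : ℝ) * Real.log (primesProd S) + 13 * (primesProd S : ℝ) + 25 := by
        nlinarith


/-! ### Elementary lemmas for the translation `U = A/C`, `V = B/C` (§8) -/

/-- The explicit bound `x ↦ 4.8 x log x + 13 x + 25` is monotone on `[1, ∞)` (used in §8 to pass from
`R = rad(ABC)` to `P ≥ R`). [cite: MurtyPasten2013, §8 (proof of Thm 1.1, p. 3753)] -/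
theorem bound_mono {x y : ℝ} (hx : 1 ≤ x) (hxy : x ≤ y) :
    4.8 * x * Real.log x + 13 * x + 25 ≤ 4.8 * y * Real.log y + 13 * y + 25 := by
  have hlx : 0 ≤ Real.log x := Real.log_nonneg hx
  have hlxy : Real.log x ≤ Real.log y := Real.log_le_log (by linarith) hxy
  have : x * Real.log x ≤ y * Real.log y := mul_le_mul hxy hlxy hlx (by linarith)
  linarith

/-- `h(m/n) = log max(|m|, n)` for coprime `m, n` with `n > 0` (MP p. 3740: "`h(q) = log max{|a|,|b|}`
where `a, b` are coprime integers with `q = a/b`"; Mathlib `Rat.logHeight₁_eq_log_max`).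
[cite: MurtyPasten2013, §1 p. 3740 (definition of h)] -/
theorem logHeight₁_div_eq {m n : ℤ} (hn : 0 < n) (hmn : IsCoprime m n) :
    logHeight₁ ((m : ℚ) / n) = Real.log ((max |m| n : ℤ) : ℝ) := by
  have hcop : Nat.Coprime m.natAbs n.natAbs := Int.isCoprime_iff_gcd_eq_one.mp hmn
  have hnum : ((m : ℚ) / n).num = m := Rat.num_div_eq_of_coprime hn hcop
  have hden : (((m : ℚ) / n).den : ℤ) = n := Rat.den_div_eq_of_coprime hn hcop
  rw [Rat.logHeight₁_eq_log_max, hnum]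
  congr 1
  have : ((max m.natAbs ((m : ℚ) / n).den : ℕ) : ℤ) = max |m| n := by
    rw [Nat.cast_max, hden, Int.natCast_natAbs]
  rw [← this, Int.cast_natCast]

/-- From `gcd(gcd(a,b),c) = 1` and `a + b = c`: `a` and `c` are coprime (any common divisor of `a, c`
divides `b = c − a`); the pairwise coprimality of "coprime `A, B, C` with `A + B = C`" used in §8.
[cite: MurtyPasten2013, §8 (proof of Thm 1.2, p. 3752)] -/
theorem isCoprime_of_add_eq {a b c : ℤ} (habc : a + b = c) (hg : Int.gcd (Int.gcd a b : ℤ) c = 1) :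
    IsCoprime a c := by
  rw [Int.isCoprime_iff_gcd_eq_one]
  set d : ℕ := Int.gcd a c with hd
  have ha : (d : ℤ) ∣ a := Int.gcd_dvd_left _ _
  have hc : (d : ℤ) ∣ c := Int.gcd_dvd_right _ _
  have hb : (d : ℤ) ∣ b := by
    have : b = c - a := by rw [← habc]; ring
    rw [this]; exact dvd_sub hc ha
  have h1 : d ∣ Int.gcd (Int.gcd a b : ℤ) c := Int.dvd_gcd (Int.dvd_coe_gcd ha hb) hc
  rw [hg] at h1
  exact Nat.eq_one_of_dvd_one h1

/-- `rad(n) ≤ P = ∏_{p ∈ S} p` when every prime factor of `n` lies in `S` (indeed `rad(n) ∣ P`):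
"in particular `rad(ABC)` divides the product of the primes in `S`" (§8, p. 3753).
[cite: MurtyPasten2013, §8 (proof of Thm 1.1, p. 3753)] -/
theorem radical_le_primesProd {S : Finset ℕ} (hS : ∀ p ∈ S, p.Prime) {n : ℕ}
    (hsub : n.primeFactors ⊆ S) : radical n ≤ primesProd S := by
  refine Nat.le_of_dvd (one_le_primesProd hS) ?_
  rw [Nat.radical_eq_prod_primeFactors, primesProd]
  exact Finset.prod_dvd_prod_of_subset _ _ _ hsub

/-- **The dictionary of §8 (proof of Thm 1.1, p. 3753).** An `S`-unit solution of `U + V = 1` yields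
coprime non-zero integers `A + B = C` — `A = num(U)`, `C = den(U) > 0`, `B = C − A`, so that
`U = A/C`, `V = B/C` (MP write `U = −A/C`, `V = −B/C` with `A + B + C = 0`) — all of whose prime
factors lie in `S` ("in particular `rad(ABC)` divides the product of the primes in `S`"), with
`max{h(U), h(V)} ≤ log max{|A|,|B|,|C|}` (in fact equality). [cite: MurtyPasten2013, §8 (proof of Thm 1.1, p. 3753)] -/
theorem exists_abc_of_sUnit {S : Finset ℕ} {U V : ℚ} (hU : IsSUnit S U)
    (hV : IsSUnit S V) (hUV : U + V = 1) :
    ∃ A B C : ℤ, A ≠ 0 ∧ B ≠ 0 ∧ 0 < C ∧ A + B = C ∧ Int.gcd (Int.gcd A B : ℤ) C = 1 ∧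
      (A * B * C).natAbs.primeFactors ⊆ S ∧
      max (logHeight₁ U) (logHeight₁ V) ≤ Real.log ((max |A| (max |B| |C|) : ℤ) : ℝ) := by
  set A : ℤ := U.num with hAdef
  set C : ℤ := (U.den : ℤ) with hCdef
  set B : ℤ := C - A with hBdef
  have hC : 0 < C := by rw [hCdef]; exact_mod_cast U.den_pos
  have hC0 : (C : ℚ) ≠ 0 := by exact_mod_cast hC.ne'
  have hAC : IsCoprime A C := Rat.isCoprime_num_den U
  have hBC : IsCoprime B C := by
    have h' := (hAC.neg_left).add_mul_left_left 1
    rwa [show -A + C * 1 = B by rw [hBdef]; ring] at h'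
  have hUeq : U = (A : ℚ) / C := (Rat.num_div_den U).symm
  have hVeq : V = (B : ℚ) / C := by
    have : V = 1 - U := eq_sub_of_add_eq' hUV
    rw [this, hUeq, hBdef, Int.cast_sub, sub_div, div_self hC0]
  have hA0 : A ≠ 0 := Rat.num_ne_zero.mpr hU.ne_zero
  have hB0 : B ≠ 0 := by
    intro hB
    apply hV.ne_zero
    rw [hVeq, hB, Int.cast_zero, zero_div]
  have hABC : A + B = C := by rw [hBdef]; ring
  have hgcd : Int.gcd (Int.gcd A B : ℤ) C = 1 := by
    have h1 : ((Int.gcd (Int.gcd A B : ℤ) C : ℕ) : ℤ) ∣ A :=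
      (Int.gcd_dvd_left _ _).trans (Int.gcd_dvd_left _ _)
    have h2 : ((Int.gcd (Int.gcd A B : ℤ) C : ℕ) : ℤ) ∣ C := Int.gcd_dvd_right _ _
    have hu := hAC.isUnit_of_dvd' h1 h2
    rw [Int.isUnit_iff_natAbs_eq, Int.natAbs_natCast] at hu
    exact hu
  have hVnum : V.num = B := by
    rw [hVeq]; exact Rat.num_div_eq_of_coprime hC (Int.isCoprime_iff_gcd_eq_one.mp hBC)
  have hsub : (A * B * C).natAbs.primeFactors ⊆ S := by
    rw [Int.natAbs_mul, Int.natAbs_mul,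
      Nat.primeFactors_mul (by positivity) (Int.natAbs_ne_zero.mpr hC.ne'),
      Nat.primeFactors_mul (Int.natAbs_ne_zero.mpr hA0) (Int.natAbs_ne_zero.mpr hB0)]
    refine Finset.union_subset (Finset.union_subset hU.2.1 ?_) ?_
    · rw [← hVnum]; exact hV.2.1
    · rw [hCdef, Int.natAbs_natCast]; exact hU.2.2
  have hhU : logHeight₁ U ≤ Real.log ((max |A| (max |B| |C|) : ℤ) : ℝ) := by
    rw [hUeq, logHeight₁_div_eq hC hAC]
    refine Real.log_le_log (by exact_mod_cast lt_max_of_lt_right hC) ?_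
    exact_mod_cast max_le_max_left |A| ((le_abs_self C).trans (le_max_right |B| |C|))
  have hhV : logHeight₁ V ≤ Real.log ((max |A| (max |B| |C|) : ℤ) : ℝ) := by
    rw [hVeq, logHeight₁_div_eq hC hBC]
    refine Real.log_le_log (by exact_mod_cast lt_max_of_lt_right hC) ?_
    exact_mod_cast (max_le_max_left |B| (le_abs_self C)).trans (le_max_right |A| (max |B| |C|))
  exact ⟨A, B, C, hA0, hB0, hC, hABC, hgcd, hsub, max_le hhU hhV⟩

/-! ### Thm 1.1 ⟺ Thm 1.2 -/

/-- **§8, proof of Theorem 1.1 (p. 3753): Thm 1.2 ⟹ Thm 1.1** (PROVED). For `U, V ∈ ℤ_S^×` with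
`U + V = 1`, the integers `A + B = C` of `exists_abc_of_sUnit` have `rad(ABC) ≤ P`, and the bound of
Thm 1.2 is monotone in `R ≥ 1`. [cite: MurtyPasten2013, §8 (proof of Thm 1.1, p. 3753)] -/
theorem sUnit_height_lt_of_abc_log_max_lt (h : abc_log_max_lt) : sUnit_height_lt := by
  intro S hS U V hU hV hUV
  obtain ⟨A, B, C, hA0, hB0, hC, hABC, hg, hsub, hmax⟩ := exists_abc_of_sUnit hU hV hUV
  have hlt := h A B C hA0 hB0 hC.ne' hABC hg
  have hRP : ((radical (A * B * C).natAbs : ℕ) : ℝ) ≤ (primesProd S : ℝ) := by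
    exact_mod_cast radical_le_primesProd hS hsub
  have hR1 : (1 : ℝ) ≤ ((radical (A * B * C).natAbs : ℕ) : ℝ) := by
    exact_mod_cast Nat.radical_pos _
  exact (hmax.trans_lt hlt).trans_le (bound_mono hR1 hRP)

/-- **Thm 1.1 ⟹ Thm 1.2, case `C > 0`** (PROVED): for coprime non-zero `a + b = c` with `c > 0`, the
rationals `U = a/c`, `V = b/c` are `S`-units for `S = {p ∣ abc}` (so `P = rad(abc)`), `U + V = 1`,
and `log max{|a|,|b|,|c|} ≤ max{h(U), h(V)}`. [cite: MurtyPasten2013, §1 p. 3741 ("An equivalent way to state the previous theorem")] -/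
theorem abc_log_max_lt_of_sUnit_height_lt_pos (h : sUnit_height_lt) {a b c : ℤ} (ha : a ≠ 0)
    (hb : b ≠ 0) (hc : 0 < c) (habc : a + b = c) (hg : Int.gcd (Int.gcd a b : ℤ) c = 1) :
    Real.log ((max |a| (max |b| |c|) : ℤ) : ℝ) <
      4.8 * ((radical (a * b * c).natAbs : ℕ) : ℝ) * Real.log ((radical (a * b * c).natAbs : ℕ) : ℝ) +
        13 * ((radical (a * b * c).natAbs : ℕ) : ℝ) + 25 := by
  have hac : IsCoprime a c := isCoprime_of_add_eq habc hg
  have hbc : IsCoprime b c := by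
    refine isCoprime_of_add_eq (by rw [← habc]; ring : b + a = c) ?_
    rwa [Int.gcd_comm b a]
  have hc0 : (c : ℚ) ≠ 0 := by exact_mod_cast hc.ne'
  have habc0 : (a * b * c).natAbs ≠ 0 := Int.natAbs_ne_zero.mpr (by positivity)
  set S : Finset ℕ := (a * b * c).natAbs.primeFactors with hSdef
  have hS : ∀ p ∈ S, p.Prime := fun p hp => Nat.prime_of_mem_primeFactors hp
  have hP : primesProd S = radical (a * b * c).natAbs := by
    rw [primesProd, hSdef, Nat.radical_eq_prod_primeFactors]
  have hcopa : Nat.Coprime a.natAbs c.natAbs := Int.isCoprime_iff_gcd_eq_one.mp hac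
  have hcopb : Nat.Coprime b.natAbs c.natAbs := Int.isCoprime_iff_gcd_eq_one.mp hbc
  have hden_a : ((a : ℚ) / c).den = c.natAbs := by
    have := Rat.den_div_eq_of_coprime hc hcopa
    exact_mod_cast congrArg Int.natAbs this
  have hden_b : ((b : ℚ) / c).den = c.natAbs := by
    have := Rat.den_div_eq_of_coprime hc hcopb
    exact_mod_cast congrArg Int.natAbs this
  have hsub : ∀ x : ℤ, x ∣ a * b * c → x.natAbs.primeFactors ⊆ S := fun x hx =>
    Nat.primeFactors_mono (Int.natAbs_dvd_natAbs.mpr hx) habc0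
  have hU : IsSUnit S ((a : ℚ) / c) := by
    refine ⟨div_ne_zero (by exact_mod_cast ha) hc0, ?_, ?_⟩
    · rw [Rat.num_div_eq_of_coprime hc hcopa]; exact hsub a ⟨b * c, by ring⟩
    · rw [hden_a]; exact hsub c ⟨a * b, by ring⟩
  have hV : IsSUnit S ((b : ℚ) / c) := by
    refine ⟨div_ne_zero (by exact_mod_cast hb) hc0, ?_, ?_⟩
    · rw [Rat.num_div_eq_of_coprime hc hcopb]; exact hsub b ⟨a * c, by ring⟩
    · rw [hden_b]; exact hsub c ⟨a * b, by ring⟩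
  have hsum : (a : ℚ) / c + (b : ℚ) / c = 1 := by
    rw [← add_div, ← Int.cast_add, habc, div_self hc0]
  have hmain := h S hS _ _ hU hV hsum
  rw [hP, logHeight₁_div_eq hc hac, logHeight₁_div_eq hc hbc] at hmain
  refine lt_of_le_of_lt ?_ hmain
  rw [abs_of_pos hc]
  rcases le_total |a| |b| with hab | hab
  · have : max |a| (max |b| c) = max |b| c := max_eq_right (le_max_of_le_left hab)
    rw [this]; exact le_max_right _ _
  · have : max |a| (max |b| c) = max |a| c := by rw [← max_assoc, max_eq_left hab]
    rw [this]; exact le_max_left _ _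

/-- **Thm 1.1 ⟹ Thm 1.2** (PROVED; "an equivalent way to state the previous theorem", p. 3741): the
case `C < 0` is reduced to `C > 0` by `(A, B, C) ↦ (−A, −B, −C)`.
[cite: MurtyPasten2013, §1 p. 3741 ("An equivalent way to state the previous theorem")] -/
theorem abc_log_max_lt_of_sUnit_height_lt (h : sUnit_height_lt) : abc_log_max_lt := by
  intro a b c ha hb hc habc hg
  rcases lt_or_gt_of_ne hc with hneg | hpos
  · have h' := abc_log_max_lt_of_sUnit_height_lt_pos h (neg_ne_zero.mpr ha) (neg_ne_zero.mpr hb)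
      (neg_pos.mpr hneg) (by rw [← habc]; ring) (by simpa using hg)
    simp only [abs_neg] at h'
    have hprod : (-a * -b * -c).natAbs = (a * b * c).natAbs := by
      rw [show -a * -b * -c = -(a * b * c) by ring, Int.natAbs_neg]
    rwa [hprod] at h'
  · exact abc_log_max_lt_of_sUnit_height_lt_pos h ha hb hpos habc hg

/-- **Theorems 1.1 and 1.2 are equivalent** (PROVED), as stated on p. 3741.
[cite: MurtyPasten2013, §1 p. 3741] -/
theorem sUnit_height_lt_iff_abc_log_max_lt : sUnit_height_lt ↔ abc_log_max_lt :=
  ⟨abc_log_max_lt_of_sUnit_height_lt, sUnit_height_lt_of_abc_log_max_lt⟩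

/-- The explicit Thm 1.2 of Murty–Pasten, as printed, follows from von Känel–Matschke's Prop. 10.2
(through Thm 1.1). [cite: VonkanelMatschke2023, Prop. 10.2 (sentence on Murty–Pasten)] -/
theorem abc_log_max_lt_of_vonKanelMatschke (h : sUnitEquation_height_le) : abc_log_max_lt :=
  abc_log_max_lt_of_sUnit_height_lt (sUnit_height_lt_of_vonKanelMatschke h)

end MurtyPasten

end Literature.NumberTheory.DiophantineGeometry

end
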